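import Summits.CriticalPhenomena.PercolationContinuityZ3.Theorems.PercNearOneGluingNoHeavyLowerTailQ44SingleSourceEMonoATerminal

/-!
# E-MONO-A along the pencil of every pair `s(x,z)` with `x` in `a`'s sure cluster and `z ∈ {b, c, y}` (all `n`)

Support file for crux `stmt-CriticalPhenomena-4575` (master-family programme, row `Q44`, single-source packing; MONO-A
line), seat `prim-bnk-1` gen 33; memo `run/shared/lean/prim/prim-l12/FROM-prim-bnk-1-gen33-LAW-LEVEL-MONO-A.md` §4, §8.

`…Q44SingleSourceEMonoATerminal` proves `SingleSourceLaw.EMonoA`'s pencil inequality for the pairs `s(a,b)`, `s(a,c)`,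
`s(a,y)`.  Here the same for `s(x,b)`, `s(x,c)`, `s(x,y)` whenever `x` is SURELY joined to `a` in `w[s(x,z)↦0]` — exactly the
hypothesis form of `EMonoA` (`Q44b.sureJoined`): almost surely `a ↔ x`, so gluing `s(x,z)` and gluing `s(a,z)` produce the same
pattern of the marked points (`insert_xb_mem_atom_iff`, …), the gluing dictionaries coincide (`cell_update_one_xb/xc/xy`), and
the defects are those of the terminal file (types B and D).  So of p6's hypotheses `EMonoA n a b c y` / `MixA n a b c y` exactly
the pairs with `z ∉ {b,c,y}` (the core step of the memo, §5) remain: `eMonoA_of_nonterminal`, `law_nonneg_of_eMonoA_nonterminal`,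
`pack_singleSource_of_eMonoA_nonterminal` (p6's reduction with the terminal pairs discharged).  No named facts, no sorries, no definitions.
-/

noncomputable section

namespace Summit.CriticalPhenomena.PercolationContinuityZ3.Theorems

namespace SingleSourceLaw

open MeasureTheory Set Literature.Probability.LatticeModels Literature.Probability.Percolation
open FourPointAtoms
open Summit.CriticalPhenomena.PercolationContinuityZ3.Cruxes.AdditiveGluing.TieLine.ConnAtoms
open scoped Classical

variable {n : ℕ}

/-- On `{a ↔ x}`, gluing `s(x,b)` and gluing `s(a,b)` give the same pattern of the marked points. [this work] -/
theorem insert_xb_mem_atom_iff (a b c y x : Fin n) (ω : BondConfig (Fin n)) (hax : (openGraph ω).Reachable a x)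
    (π₀ : Fin 4 → Fin 4) :
    insert s(x, b) ω ∈ atom (quad a b c y) π₀ ↔ insert s(a, b) ω ∈ atom (quad a b c y) π₀ := by
  simp only [mem_atom, KNSep.reachable_insert_iff]
  have h1 : ∀ t, (openGraph ω).Reachable t x ↔ (openGraph ω).Reachable t a :=
    fun t => ⟨fun h => h.trans hax.symm, fun h => h.trans hax⟩
  have h2 : ∀ t, (openGraph ω).Reachable x t ↔ (openGraph ω).Reachable a t :=
    fun t => ⟨fun h => hax.trans h, fun h => hax.symm.trans h⟩
  simp only [h1, h2]

/-- Gluing dictionary for `s(x,b)` with `x` surely joined to `a` in `w₀ = w[s(x,b)↦0]`: the cells of `w[s(x,b)↦1]` as sums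
of cells of `w₀`. [this work] -/
theorem cell_update_one_xb (w : Sym2 (Fin n) → unitInterval) (a b c y x : Fin n)
    (hx : Q44b.sureJoined (Function.update w s(x, b) 0) a x) (i : Fin 15) :
    cell (Function.update w s(x, b) 1) a b c y i =
      (if (∀ j k : Fin 4, ((pat4 0 j = pat4 0 k) ∨ (pat4 0 j = pat4 0 0 ∧ pat4 0 1 = pat4 0 k) ∨
          (pat4 0 j = pat4 0 1 ∧ pat4 0 0 = pat4 0 k)) ↔ pat4 i j = pat4 i k) then cell (Function.update w s(x, b) 0) a b c y 0 else 0) +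
      (if (∀ j k : Fin 4, ((pat4 1 j = pat4 1 k) ∨ (pat4 1 j = pat4 1 0 ∧ pat4 1 1 = pat4 1 k) ∨
          (pat4 1 j = pat4 1 1 ∧ pat4 1 0 = pat4 1 k)) ↔ pat4 i j = pat4 i k) then cell (Function.update w s(x, b) 0) a b c y 1 else 0) +
      (if (∀ j k : Fin 4, ((pat4 2 j = pat4 2 k) ∨ (pat4 2 j = pat4 2 0 ∧ pat4 2 1 = pat4 2 k) ∨
          (pat4 2 j = pat4 2 1 ∧ pat4 2 0 = pat4 2 k)) ↔ pat4 i j = pat4 i k) then cell (Function.update w s(x, b) 0) a b c y 2 else 0) +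
      (if (∀ j k : Fin 4, ((pat4 3 j = pat4 3 k) ∨ (pat4 3 j = pat4 3 0 ∧ pat4 3 1 = pat4 3 k) ∨
          (pat4 3 j = pat4 3 1 ∧ pat4 3 0 = pat4 3 k)) ↔ pat4 i j = pat4 i k) then cell (Function.update w s(x, b) 0) a b c y 3 else 0) +
      (if (∀ j k : Fin 4, ((pat4 4 j = pat4 4 k) ∨ (pat4 4 j = pat4 4 0 ∧ pat4 4 1 = pat4 4 k) ∨
          (pat4 4 j = pat4 4 1 ∧ pat4 4 0 = pat4 4 k)) ↔ pat4 i j = pat4 i k) then cell (Function.update w s(x, b) 0) a b c y 4 else 0) +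
      (if (∀ j k : Fin 4, ((pat4 5 j = pat4 5 k) ∨ (pat4 5 j = pat4 5 0 ∧ pat4 5 1 = pat4 5 k) ∨
          (pat4 5 j = pat4 5 1 ∧ pat4 5 0 = pat4 5 k)) ↔ pat4 i j = pat4 i k) then cell (Function.update w s(x, b) 0) a b c y 5 else 0) +
      (if (∀ j k : Fin 4, ((pat4 6 j = pat4 6 k) ∨ (pat4 6 j = pat4 6 0 ∧ pat4 6 1 = pat4 6 k) ∨
          (pat4 6 j = pat4 6 1 ∧ pat4 6 0 = pat4 6 k)) ↔ pat4 i j = pat4 i k) then cell (Function.update w s(x, b) 0) a b c y 6 else 0) +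
      (if (∀ j k : Fin 4, ((pat4 7 j = pat4 7 k) ∨ (pat4 7 j = pat4 7 0 ∧ pat4 7 1 = pat4 7 k) ∨
          (pat4 7 j = pat4 7 1 ∧ pat4 7 0 = pat4 7 k)) ↔ pat4 i j = pat4 i k) then cell (Function.update w s(x, b) 0) a b c y 7 else 0) +
      (if (∀ j k : Fin 4, ((pat4 8 j = pat4 8 k) ∨ (pat4 8 j = pat4 8 0 ∧ pat4 8 1 = pat4 8 k) ∨
          (pat4 8 j = pat4 8 1 ∧ pat4 8 0 = pat4 8 k)) ↔ pat4 i j = pat4 i k) then cell (Function.update w s(x, b) 0) a b c y 8 else 0) +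
      (if (∀ j k : Fin 4, ((pat4 9 j = pat4 9 k) ∨ (pat4 9 j = pat4 9 0 ∧ pat4 9 1 = pat4 9 k) ∨
          (pat4 9 j = pat4 9 1 ∧ pat4 9 0 = pat4 9 k)) ↔ pat4 i j = pat4 i k) then cell (Function.update w s(x, b) 0) a b c y 9 else 0) +
      (if (∀ j k : Fin 4, ((pat4 10 j = pat4 10 k) ∨ (pat4 10 j = pat4 10 0 ∧ pat4 10 1 = pat4 10 k) ∨
          (pat4 10 j = pat4 10 1 ∧ pat4 10 0 = pat4 10 k)) ↔ pat4 i j = pat4 i k) then cell (Function.update w s(x, b) 0) a b c y 10 else 0) +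
      (if (∀ j k : Fin 4, ((pat4 11 j = pat4 11 k) ∨ (pat4 11 j = pat4 11 0 ∧ pat4 11 1 = pat4 11 k) ∨
          (pat4 11 j = pat4 11 1 ∧ pat4 11 0 = pat4 11 k)) ↔ pat4 i j = pat4 i k) then cell (Function.update w s(x, b) 0) a b c y 11 else 0) +
      (if (∀ j k : Fin 4, ((pat4 12 j = pat4 12 k) ∨ (pat4 12 j = pat4 12 0 ∧ pat4 12 1 = pat4 12 k) ∨
          (pat4 12 j = pat4 12 1 ∧ pat4 12 0 = pat4 12 k)) ↔ pat4 i j = pat4 i k) then cell (Function.update w s(x, b) 0) a b c y 12 else 0) +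
      (if (∀ j k : Fin 4, ((pat4 13 j = pat4 13 k) ∨ (pat4 13 j = pat4 13 0 ∧ pat4 13 1 = pat4 13 k) ∨
          (pat4 13 j = pat4 13 1 ∧ pat4 13 0 = pat4 13 k)) ↔ pat4 i j = pat4 i k) then cell (Function.update w s(x, b) 0) a b c y 13 else 0) +
      (if (∀ j k : Fin 4, ((pat4 14 j = pat4 14 k) ∨ (pat4 14 j = pat4 14 0 ∧ pat4 14 1 = pat4 14 k) ∨
          (pat4 14 j = pat4 14 1 ∧ pat4 14 0 = pat4 14 k)) ↔ pat4 i j = pat4 i k) then cell (Function.update w s(x, b) 0) a b c y 14 else 0) := by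
  have glue : (prodBernoulli (Function.update w s(x, b) 1)).real (atom (quad a b c y) (pat4 i)) =
      (prodBernoulli (Function.update w s(x, b) 0)).real
        {ω : BondConfig (Fin n) | insert s(x, b) ω ∈ atom (quad a b c y) (pat4 i)} := by
    have h1 : Function.update w s(x, b) 1 = Function.update (Function.update w s(x, b) 0) s(x, b) 1 := by
      simp only [Function.update_idem]
    rw [h1]
    exact prodBernoulli_real_update_one_eq (TargetExploration.determinedBy_univ _) (Function.update w s(x, b) 0)
      (Finset.mem_univ _)
  have hae : (prodBernoulli (Function.update w s(x, b) 0)).real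
        {ω : BondConfig (Fin n) | insert s(x, b) ω ∈ atom (quad a b c y) (pat4 i)} =
      (prodBernoulli (Function.update w s(x, b) 0)).real
        {ω : BondConfig (Fin n) | insert s(a, b) ω ∈ atom (quad a b c y) (pat4 i)} := by
    refine measureReal_congr ?_
    filter_upwards [Q44b.ae_reachable_of_sureJoined _ a x hx] with ω hω
    exact propext (insert_xb_mem_atom_iff a b c y x ω hω (pat4 i))
  unfold cell
  rw [glue, hae, measureReal_eq_cellSum (Function.update w s(x, b) 0) a b c y (hasPattern_insert_ab a b c y (pat4 i))]
  rfl

/-- On `{a ↔ x}`, gluing `s(x,c)` and gluing `s(a,c)` give the same pattern of the marked points. [this work] -/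
theorem insert_xc_mem_atom_iff (a b c y x : Fin n) (ω : BondConfig (Fin n)) (hax : (openGraph ω).Reachable a x)
    (π₀ : Fin 4 → Fin 4) :
    insert s(x, c) ω ∈ atom (quad a b c y) π₀ ↔ insert s(a, c) ω ∈ atom (quad a b c y) π₀ := by
  simp only [mem_atom, KNSep.reachable_insert_iff]
  have h1 : ∀ t, (openGraph ω).Reachable t x ↔ (openGraph ω).Reachable t a :=
    fun t => ⟨fun h => h.trans hax.symm, fun h => h.trans hax⟩
  have h2 : ∀ t, (openGraph ω).Reachable x t ↔ (openGraph ω).Reachable a t :=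
    fun t => ⟨fun h => hax.trans h, fun h => hax.symm.trans h⟩
  simp only [h1, h2]

/-- Gluing dictionary for `s(x,c)` with `x` surely joined to `a` in `w₀ = w[s(x,c)↦0]`: the cells of `w[s(x,c)↦1]` as sums
of cells of `w₀`. [this work] -/
theorem cell_update_one_xc (w : Sym2 (Fin n) → unitInterval) (a b c y x : Fin n)
    (hx : Q44b.sureJoined (Function.update w s(x, c) 0) a x) (i : Fin 15) :
    cell (Function.update w s(x, c) 1) a b c y i =
      (if (∀ j k : Fin 4, ((pat4 0 j = pat4 0 k) ∨ (pat4 0 j = pat4 0 0 ∧ pat4 0 2 = pat4 0 k) ∨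
          (pat4 0 j = pat4 0 2 ∧ pat4 0 0 = pat4 0 k)) ↔ pat4 i j = pat4 i k) then cell (Function.update w s(x, c) 0) a b c y 0 else 0) +
      (if (∀ j k : Fin 4, ((pat4 1 j = pat4 1 k) ∨ (pat4 1 j = pat4 1 0 ∧ pat4 1 2 = pat4 1 k) ∨
          (pat4 1 j = pat4 1 2 ∧ pat4 1 0 = pat4 1 k)) ↔ pat4 i j = pat4 i k) then cell (Function.update w s(x, c) 0) a b c y 1 else 0) +
      (if (∀ j k : Fin 4, ((pat4 2 j = pat4 2 k) ∨ (pat4 2 j = pat4 2 0 ∧ pat4 2 2 = pat4 2 k) ∨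
          (pat4 2 j = pat4 2 2 ∧ pat4 2 0 = pat4 2 k)) ↔ pat4 i j = pat4 i k) then cell (Function.update w s(x, c) 0) a b c y 2 else 0) +
      (if (∀ j k : Fin 4, ((pat4 3 j = pat4 3 k) ∨ (pat4 3 j = pat4 3 0 ∧ pat4 3 2 = pat4 3 k) ∨
          (pat4 3 j = pat4 3 2 ∧ pat4 3 0 = pat4 3 k)) ↔ pat4 i j = pat4 i k) then cell (Function.update w s(x, c) 0) a b c y 3 else 0) +
      (if (∀ j k : Fin 4, ((pat4 4 j = pat4 4 k) ∨ (pat4 4 j = pat4 4 0 ∧ pat4 4 2 = pat4 4 k) ∨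
          (pat4 4 j = pat4 4 2 ∧ pat4 4 0 = pat4 4 k)) ↔ pat4 i j = pat4 i k) then cell (Function.update w s(x, c) 0) a b c y 4 else 0) +
      (if (∀ j k : Fin 4, ((pat4 5 j = pat4 5 k) ∨ (pat4 5 j = pat4 5 0 ∧ pat4 5 2 = pat4 5 k) ∨
          (pat4 5 j = pat4 5 2 ∧ pat4 5 0 = pat4 5 k)) ↔ pat4 i j = pat4 i k) then cell (Function.update w s(x, c) 0) a b c y 5 else 0) +
      (if (∀ j k : Fin 4, ((pat4 6 j = pat4 6 k) ∨ (pat4 6 j = pat4 6 0 ∧ pat4 6 2 = pat4 6 k) ∨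
          (pat4 6 j = pat4 6 2 ∧ pat4 6 0 = pat4 6 k)) ↔ pat4 i j = pat4 i k) then cell (Function.update w s(x, c) 0) a b c y 6 else 0) +
      (if (∀ j k : Fin 4, ((pat4 7 j = pat4 7 k) ∨ (pat4 7 j = pat4 7 0 ∧ pat4 7 2 = pat4 7 k) ∨
          (pat4 7 j = pat4 7 2 ∧ pat4 7 0 = pat4 7 k)) ↔ pat4 i j = pat4 i k) then cell (Function.update w s(x, c) 0) a b c y 7 else 0) +
      (if (∀ j k : Fin 4, ((pat4 8 j = pat4 8 k) ∨ (pat4 8 j = pat4 8 0 ∧ pat4 8 2 = pat4 8 k) ∨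
          (pat4 8 j = pat4 8 2 ∧ pat4 8 0 = pat4 8 k)) ↔ pat4 i j = pat4 i k) then cell (Function.update w s(x, c) 0) a b c y 8 else 0) +
      (if (∀ j k : Fin 4, ((pat4 9 j = pat4 9 k) ∨ (pat4 9 j = pat4 9 0 ∧ pat4 9 2 = pat4 9 k) ∨
          (pat4 9 j = pat4 9 2 ∧ pat4 9 0 = pat4 9 k)) ↔ pat4 i j = pat4 i k) then cell (Function.update w s(x, c) 0) a b c y 9 else 0) +
      (if (∀ j k : Fin 4, ((pat4 10 j = pat4 10 k) ∨ (pat4 10 j = pat4 10 0 ∧ pat4 10 2 = pat4 10 k) ∨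
          (pat4 10 j = pat4 10 2 ∧ pat4 10 0 = pat4 10 k)) ↔ pat4 i j = pat4 i k) then cell (Function.update w s(x, c) 0) a b c y 10 else 0) +
      (if (∀ j k : Fin 4, ((pat4 11 j = pat4 11 k) ∨ (pat4 11 j = pat4 11 0 ∧ pat4 11 2 = pat4 11 k) ∨
          (pat4 11 j = pat4 11 2 ∧ pat4 11 0 = pat4 11 k)) ↔ pat4 i j = pat4 i k) then cell (Function.update w s(x, c) 0) a b c y 11 else 0) +
      (if (∀ j k : Fin 4, ((pat4 12 j = pat4 12 k) ∨ (pat4 12 j = pat4 12 0 ∧ pat4 12 2 = pat4 12 k) ∨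
          (pat4 12 j = pat4 12 2 ∧ pat4 12 0 = pat4 12 k)) ↔ pat4 i j = pat4 i k) then cell (Function.update w s(x, c) 0) a b c y 12 else 0) +
      (if (∀ j k : Fin 4, ((pat4 13 j = pat4 13 k) ∨ (pat4 13 j = pat4 13 0 ∧ pat4 13 2 = pat4 13 k) ∨
          (pat4 13 j = pat4 13 2 ∧ pat4 13 0 = pat4 13 k)) ↔ pat4 i j = pat4 i k) then cell (Function.update w s(x, c) 0) a b c y 13 else 0) +
      (if (∀ j k : Fin 4, ((pat4 14 j = pat4 14 k) ∨ (pat4 14 j = pat4 14 0 ∧ pat4 14 2 = pat4 14 k) ∨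
          (pat4 14 j = pat4 14 2 ∧ pat4 14 0 = pat4 14 k)) ↔ pat4 i j = pat4 i k) then cell (Function.update w s(x, c) 0) a b c y 14 else 0) := by
  have glue : (prodBernoulli (Function.update w s(x, c) 1)).real (atom (quad a b c y) (pat4 i)) =
      (prodBernoulli (Function.update w s(x, c) 0)).real
        {ω : BondConfig (Fin n) | insert s(x, c) ω ∈ atom (quad a b c y) (pat4 i)} := by
    have h1 : Function.update w s(x, c) 1 = Function.update (Function.update w s(x, c) 0) s(x, c) 1 := by
      simp only [Function.update_idem]
    rw [h1]
    exact prodBernoulli_real_update_one_eq (TargetExploration.determinedBy_univ _) (Function.update w s(x, c) 0)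
      (Finset.mem_univ _)
  have hae : (prodBernoulli (Function.update w s(x, c) 0)).real
        {ω : BondConfig (Fin n) | insert s(x, c) ω ∈ atom (quad a b c y) (pat4 i)} =
      (prodBernoulli (Function.update w s(x, c) 0)).real
        {ω : BondConfig (Fin n) | insert s(a, c) ω ∈ atom (quad a b c y) (pat4 i)} := by
    refine measureReal_congr ?_
    filter_upwards [Q44b.ae_reachable_of_sureJoined _ a x hx] with ω hω
    exact propext (insert_xc_mem_atom_iff a b c y x ω hω (pat4 i))
  unfold cell
  rw [glue, hae, measureReal_eq_cellSum (Function.update w s(x, c) 0) a b c y (hasPattern_insert_ac a b c y (pat4 i))]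
  rfl

/-- On `{a ↔ x}`, gluing `s(x,y)` and gluing `s(a,y)` give the same pattern of the marked points. [this work] -/
theorem insert_xy_mem_atom_iff (a b c y x : Fin n) (ω : BondConfig (Fin n)) (hax : (openGraph ω).Reachable a x)
    (π₀ : Fin 4 → Fin 4) :
    insert s(x, y) ω ∈ atom (quad a b c y) π₀ ↔ insert s(a, y) ω ∈ atom (quad a b c y) π₀ := by
  simp only [mem_atom, KNSep.reachable_insert_iff]
  have h1 : ∀ t, (openGraph ω).Reachable t x ↔ (openGraph ω).Reachable t a :=
    fun t => ⟨fun h => h.trans hax.symm, fun h => h.trans hax⟩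
  have h2 : ∀ t, (openGraph ω).Reachable x t ↔ (openGraph ω).Reachable a t :=
    fun t => ⟨fun h => hax.trans h, fun h => hax.symm.trans h⟩
  simp only [h1, h2]

/-- Gluing dictionary for `s(x,y)` with `x` surely joined to `a` in `w₀ = w[s(x,y)↦0]`: the cells of `w[s(x,y)↦1]` as sums
of cells of `w₀`. [this work] -/
theorem cell_update_one_xy (w : Sym2 (Fin n) → unitInterval) (a b c y x : Fin n)
    (hx : Q44b.sureJoined (Function.update w s(x, y) 0) a x) (i : Fin 15) :
    cell (Function.update w s(x, y) 1) a b c y i =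
      (if (∀ j k : Fin 4, ((pat4 0 j = pat4 0 k) ∨ (pat4 0 j = pat4 0 0 ∧ pat4 0 3 = pat4 0 k) ∨
          (pat4 0 j = pat4 0 3 ∧ pat4 0 0 = pat4 0 k)) ↔ pat4 i j = pat4 i k) then cell (Function.update w s(x, y) 0) a b c y 0 else 0) +
      (if (∀ j k : Fin 4, ((pat4 1 j = pat4 1 k) ∨ (pat4 1 j = pat4 1 0 ∧ pat4 1 3 = pat4 1 k) ∨
          (pat4 1 j = pat4 1 3 ∧ pat4 1 0 = pat4 1 k)) ↔ pat4 i j = pat4 i k) then cell (Function.update w s(x, y) 0) a b c y 1 else 0) +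
      (if (∀ j k : Fin 4, ((pat4 2 j = pat4 2 k) ∨ (pat4 2 j = pat4 2 0 ∧ pat4 2 3 = pat4 2 k) ∨
          (pat4 2 j = pat4 2 3 ∧ pat4 2 0 = pat4 2 k)) ↔ pat4 i j = pat4 i k) then cell (Function.update w s(x, y) 0) a b c y 2 else 0) +
      (if (∀ j k : Fin 4, ((pat4 3 j = pat4 3 k) ∨ (pat4 3 j = pat4 3 0 ∧ pat4 3 3 = pat4 3 k) ∨
          (pat4 3 j = pat4 3 3 ∧ pat4 3 0 = pat4 3 k)) ↔ pat4 i j = pat4 i k) then cell (Function.update w s(x, y) 0) a b c y 3 else 0) +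
      (if (∀ j k : Fin 4, ((pat4 4 j = pat4 4 k) ∨ (pat4 4 j = pat4 4 0 ∧ pat4 4 3 = pat4 4 k) ∨
          (pat4 4 j = pat4 4 3 ∧ pat4 4 0 = pat4 4 k)) ↔ pat4 i j = pat4 i k) then cell (Function.update w s(x, y) 0) a b c y 4 else 0) +
      (if (∀ j k : Fin 4, ((pat4 5 j = pat4 5 k) ∨ (pat4 5 j = pat4 5 0 ∧ pat4 5 3 = pat4 5 k) ∨
          (pat4 5 j = pat4 5 3 ∧ pat4 5 0 = pat4 5 k)) ↔ pat4 i j = pat4 i k) then cell (Function.update w s(x, y) 0) a b c y 5 else 0) +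
      (if (∀ j k : Fin 4, ((pat4 6 j = pat4 6 k) ∨ (pat4 6 j = pat4 6 0 ∧ pat4 6 3 = pat4 6 k) ∨
          (pat4 6 j = pat4 6 3 ∧ pat4 6 0 = pat4 6 k)) ↔ pat4 i j = pat4 i k) then cell (Function.update w s(x, y) 0) a b c y 6 else 0) +
      (if (∀ j k : Fin 4, ((pat4 7 j = pat4 7 k) ∨ (pat4 7 j = pat4 7 0 ∧ pat4 7 3 = pat4 7 k) ∨
          (pat4 7 j = pat4 7 3 ∧ pat4 7 0 = pat4 7 k)) ↔ pat4 i j = pat4 i k) then cell (Function.update w s(x, y) 0) a b c y 7 else 0) +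
      (if (∀ j k : Fin 4, ((pat4 8 j = pat4 8 k) ∨ (pat4 8 j = pat4 8 0 ∧ pat4 8 3 = pat4 8 k) ∨
          (pat4 8 j = pat4 8 3 ∧ pat4 8 0 = pat4 8 k)) ↔ pat4 i j = pat4 i k) then cell (Function.update w s(x, y) 0) a b c y 8 else 0) +
      (if (∀ j k : Fin 4, ((pat4 9 j = pat4 9 k) ∨ (pat4 9 j = pat4 9 0 ∧ pat4 9 3 = pat4 9 k) ∨
          (pat4 9 j = pat4 9 3 ∧ pat4 9 0 = pat4 9 k)) ↔ pat4 i j = pat4 i k) then cell (Function.update w s(x, y) 0) a b c y 9 else 0) +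
      (if (∀ j k : Fin 4, ((pat4 10 j = pat4 10 k) ∨ (pat4 10 j = pat4 10 0 ∧ pat4 10 3 = pat4 10 k) ∨
          (pat4 10 j = pat4 10 3 ∧ pat4 10 0 = pat4 10 k)) ↔ pat4 i j = pat4 i k) then cell (Function.update w s(x, y) 0) a b c y 10 else 0) +
      (if (∀ j k : Fin 4, ((pat4 11 j = pat4 11 k) ∨ (pat4 11 j = pat4 11 0 ∧ pat4 11 3 = pat4 11 k) ∨
          (pat4 11 j = pat4 11 3 ∧ pat4 11 0 = pat4 11 k)) ↔ pat4 i j = pat4 i k) then cell (Function.update w s(x, y) 0) a b c y 11 else 0) +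
      (if (∀ j k : Fin 4, ((pat4 12 j = pat4 12 k) ∨ (pat4 12 j = pat4 12 0 ∧ pat4 12 3 = pat4 12 k) ∨
          (pat4 12 j = pat4 12 3 ∧ pat4 12 0 = pat4 12 k)) ↔ pat4 i j = pat4 i k) then cell (Function.update w s(x, y) 0) a b c y 12 else 0) +
      (if (∀ j k : Fin 4, ((pat4 13 j = pat4 13 k) ∨ (pat4 13 j = pat4 13 0 ∧ pat4 13 3 = pat4 13 k) ∨
          (pat4 13 j = pat4 13 3 ∧ pat4 13 0 = pat4 13 k)) ↔ pat4 i j = pat4 i k) then cell (Function.update w s(x, y) 0) a b c y 13 else 0) +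
      (if (∀ j k : Fin 4, ((pat4 14 j = pat4 14 k) ∨ (pat4 14 j = pat4 14 0 ∧ pat4 14 3 = pat4 14 k) ∨
          (pat4 14 j = pat4 14 3 ∧ pat4 14 0 = pat4 14 k)) ↔ pat4 i j = pat4 i k) then cell (Function.update w s(x, y) 0) a b c y 14 else 0) := by
  have glue : (prodBernoulli (Function.update w s(x, y) 1)).real (atom (quad a b c y) (pat4 i)) =
      (prodBernoulli (Function.update w s(x, y) 0)).real
        {ω : BondConfig (Fin n) | insert s(x, y) ω ∈ atom (quad a b c y) (pat4 i)} := by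
    have h1 : Function.update w s(x, y) 1 = Function.update (Function.update w s(x, y) 0) s(x, y) 1 := by
      simp only [Function.update_idem]
    rw [h1]
    exact prodBernoulli_real_update_one_eq (TargetExploration.determinedBy_univ _) (Function.update w s(x, y) 0)
      (Finset.mem_univ _)
  have hae : (prodBernoulli (Function.update w s(x, y) 0)).real
        {ω : BondConfig (Fin n) | insert s(x, y) ω ∈ atom (quad a b c y) (pat4 i)} =
      (prodBernoulli (Function.update w s(x, y) 0)).real
        {ω : BondConfig (Fin n) | insert s(a, y) ω ∈ atom (quad a b c y) (pat4 i)} := by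
    refine measureReal_congr ?_
    filter_upwards [Q44b.ae_reachable_of_sureJoined _ a x hx] with ω hω
    exact propext (insert_xy_mem_atom_iff a b c y x ω hω (pat4 i))
  unfold cell
  rw [glue, hae, measureReal_eq_cellSum (Function.update w s(x, y) 0) a b c y (hasPattern_insert_ay a b c y (pat4 i))]
  rfl

/-- **E-MONO-A along the pencil of `s(x,b)`, `x` surely joined to `a`** (all `n`, all weightings): with `w₀ = w[s(a,b)↦0]`, `w₁ = w[s(a,b)↦1]`,
`bil w₀ w₀ ≤ bil w₀ w₁ + bil w₁ w₀` — the defect is `c₀c₉ + c₀c₁₀ + c₅c₇ − c₁c₉ ≥ 0` in the cells of `w₀` by the type-D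
exchange inequality. [this work] -/
theorem pencil_xb (w : Sym2 (Fin n) → unitInterval) (a b c y x : Fin n)
    (hx : Q44b.sureJoined (Function.update w s(x, b) 0) a x) :
    bil (Function.update w s(x, b) 0) (Function.update w s(x, b) 0) a b c y ≤
      bil (Function.update w s(x, b) 0) (Function.update w s(x, b) 1) a b c y +
        bil (Function.update w s(x, b) 1) (Function.update w s(x, b) 0) a b c y := by
  have hD := FourPointExchange.typeD_cell (Function.update w s(x, b) 0) a b c y
  have h0 := cell_update_one_xb w a b c y x hx 0; have h1 := cell_update_one_xb w a b c y x hx 1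
  have h5 := cell_update_one_xb w a b c y x hx 5; have h6 := cell_update_one_xb w a b c y x hx 6
  have h7 := cell_update_one_xb w a b c y x hx 7; have h8 := cell_update_one_xb w a b c y x hx 8
  have h9 := cell_update_one_xb w a b c y x hx 9; have h11 := cell_update_one_xb w a b c y x hx 11
  have h14 := cell_update_one_xb w a b c y x hx 14
  simp (config := {decide := true}) only [ite_true, ite_false, add_zero, zero_add] at h0 h1 h5 h6 h7 h8 h9 h11 h14
  have p0 := cell_nonneg (Function.update w s(x, b) 0) a b c y 0; have p9 := cell_nonneg (Function.update w s(x, b) 0) a b c y 9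
  have p10 := cell_nonneg (Function.update w s(x, b) 0) a b c y 10
  unfold bil
  rw [h0, h1, h5, h6, h7, h8, h9, h11, h14]
  nlinarith [hD, mul_nonneg p0 p9, mul_nonneg p0 p10]

/-- **E-MONO-A along the pencil of `s(x,c)`, `x` surely joined to `a`** (all `n`): the `b↔c` image of `pencil_ab`; the defect is nonnegative by
the type-D instance `μ(a|by|c)μ(ab|cy) ≤ μ(ab|c|y)μ(a|bcy)`. [this work] -/
theorem pencil_xc (w : Sym2 (Fin n) → unitInterval) (a b c y x : Fin n)
    (hx : Q44b.sureJoined (Function.update w s(x, c) 0) a x) :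
    bil (Function.update w s(x, c) 0) (Function.update w s(x, c) 0) a b c y ≤
      bil (Function.update w s(x, c) 0) (Function.update w s(x, c) 1) a b c y +
        bil (Function.update w s(x, c) 1) (Function.update w s(x, c) 0) a b c y := by
  have hD := FourPointExchange.typeD_cell (Function.update w s(x, c) 0) a c b y
  rw [Q44TopGood.cell_relabel_acby _ a b c y 1, Q44TopGood.cell_relabel_acby _ a b c y 9, Q44TopGood.cell_relabel_acby _ a b c y 5,
    Q44TopGood.cell_relabel_acby _ a b c y 7] at hD
  simp (config := {decide := true}) only [ite_true, ite_false, add_zero, zero_add] at hD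
  have h0 := cell_update_one_xc w a b c y x hx 0; have h1 := cell_update_one_xc w a b c y x hx 1
  have h5 := cell_update_one_xc w a b c y x hx 5; have h6 := cell_update_one_xc w a b c y x hx 6
  have h7 := cell_update_one_xc w a b c y x hx 7; have h8 := cell_update_one_xc w a b c y x hx 8
  have h9 := cell_update_one_xc w a b c y x hx 9; have h11 := cell_update_one_xc w a b c y x hx 11
  have h14 := cell_update_one_xc w a b c y x hx 14
  simp (config := {decide := true}) only [ite_true, ite_false, add_zero, zero_add] at h0 h1 h5 h6 h7 h8 h9 h11 h14
  have p := fun i => cell_nonneg (Function.update w s(x, c) 0) a b c y i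
  unfold bil
  rw [h0, h1, h5, h6, h7, h8, h9, h11, h14]
  nlinarith [hD, p 0, p 1, p 2, p 3, p 4, p 5, p 6, p 7, p 8, p 9, p 10, p 11, p 12, p 13, p 14,
    mul_nonneg (p 0) (p 8), mul_nonneg (p 0) (p 12), mul_nonneg (p 0) (p 2), mul_nonneg (p 6) (p 7), mul_nonneg (p 6) (p 8),
    mul_nonneg (p 8) (p 11)]

/-- **E-MONO-A along the pencil of `s(x,y)`, `x` surely joined to `a`** (all `n`): the defect is nonnegative by two type-B instances
(`μ(a|bc|y)μ(a|b|cy) ≤ μ(⊥)μ(a|bcy)`, `μ(a|bc|y)μ(ab|c|y) ≤ μ(⊥)μ(abc|y)`) and one type-D instance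
(`μ(a|bc|y)μ(ab|cy) ≤ μ(ab|c|y)μ(a|bcy)`). [this work] -/
theorem pencil_xy (w : Sym2 (Fin n) → unitInterval) (a b c y x : Fin n)
    (hx : Q44b.sureJoined (Function.update w s(x, y) 0) a x) :
    bil (Function.update w s(x, y) 0) (Function.update w s(x, y) 0) a b c y ≤
      bil (Function.update w s(x, y) 0) (Function.update w s(x, y) 1) a b c y +
        bil (Function.update w s(x, y) 1) (Function.update w s(x, y) 0) a b c y := by
  -- type B with hub b (i=a,k=c, y isolated): cell6*cell3 <= cell0*cell13
  have hB1 := FourPointExchange.typeB_cell (Function.update w s(x, y) 0) a b c y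
  -- type B with hub c (i=b,k=y, a isolated): via the relabelling (b,c,y,a)
  have hB2 := FourPointExchange.typeB_cell (Function.update w s(x, y) 0) b c y a
  rw [cell_relabel_bcya _ a b c y 6, cell_relabel_bcya _ a b c y 3, cell_relabel_bcya _ a b c y 0,
    cell_relabel_bcya _ a b c y 13] at hB2
  simp (config := {decide := true}) only [ite_true, ite_false, add_zero, zero_add] at hB2
  -- type D with roles (a,y,b,c): μ(a|bc|y)μ(ab|cy) ≤ μ(ab|c|y)μ(a|bcy)
  have hD := FourPointExchange.typeD_cell (Function.update w s(x, y) 0) a y b c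
  rw [cell_relabel_aybc _ a b c y 1, cell_relabel_aybc _ a b c y 9, cell_relabel_aybc _ a b c y 5,
    cell_relabel_aybc _ a b c y 7] at hD
  simp (config := {decide := true}) only [ite_true, ite_false, add_zero, zero_add] at hD
  have h0 := cell_update_one_xy w a b c y x hx 0; have h1 := cell_update_one_xy w a b c y x hx 1
  have h5 := cell_update_one_xy w a b c y x hx 5; have h6 := cell_update_one_xy w a b c y x hx 6
  have h7 := cell_update_one_xy w a b c y x hx 7; have h8 := cell_update_one_xy w a b c y x hx 8
  have h9 := cell_update_one_xy w a b c y x hx 9; have h11 := cell_update_one_xy w a b c y x hx 11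
  have h14 := cell_update_one_xy w a b c y x hx 14
  simp (config := {decide := true}) only [ite_true, ite_false, add_zero, zero_add] at h0 h1 h5 h6 h7 h8 h9 h11 h14
  have p := fun i => cell_nonneg (Function.update w s(x, y) 0) a b c y i
  unfold bil
  rw [h0, h1, h5, h6, h7, h8, h9, h11, h14]
  nlinarith [hB1, hB2, hD, p 0, p 1, p 2, p 3, p 4, p 5, p 6, p 7, p 8, p 9, p 10, p 11, p 12, p 13, p 14,
    mul_nonneg (p 0) (p 7), mul_nonneg (p 0) (p 9), mul_nonneg (p 0) (p 13), mul_nonneg (p 6) (p 1),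
    mul_nonneg (p 7) (p 6), mul_nonneg (p 7) (p 5), mul_nonneg (p 9) (p 11)]

/-! ### The sockets of `prim-l12-p6` gen 24, restricted to the non-terminal pairs -/

/-- **E-MONO-A from its non-terminal part**: if the pencil inequality holds for every pair `s(x,z)` with `x` surely joined to `a`
and `z ∉ {b, c, y}`, then `EMonoA n a b c y` — the terminal pairs are `pencil_xb`, `pencil_xc`, `pencil_xy`. [this work] -/
theorem eMonoA_of_nonterminal (a b c y : Fin n)
    (h : ∀ (w : Sym2 (Fin n) → unitInterval) (x z : Fin n), x ≠ z → z ≠ b → z ≠ c → z ≠ y →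
      Q44b.sureJoined (Function.update w s(x, z) 0) a x →
        bil (Function.update w s(x, z) 0) (Function.update w s(x, z) 0) a b c y ≤
          bil (Function.update w s(x, z) 0) (Function.update w s(x, z) 1) a b c y +
            bil (Function.update w s(x, z) 1) (Function.update w s(x, z) 0) a b c y) :
    EMonoA n a b c y := by
  intro w x z hxz hx
  by_cases hb : z = b
  · subst hb; exact pencil_xb w a z c y x hx
  by_cases hc : z = c
  · subst hc; exact pencil_xc w a b z y x hx
  by_cases hy : z = y
  · subst hy; exact pencil_xy w a b c z x hx
  exact h w x z hxz hb hc hy hx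

/-- **The single-source law, all `n`, from E-MONO-A at the NON-TERMINAL pairs only** (`SingleSourceLaw.law_nonneg_of_eMonoA`
with the terminal pairs discharged). [this work] -/
theorem law_nonneg_of_eMonoA_nonterminal (a b c y : Fin n)
    (h : ∀ (w : Sym2 (Fin n) → unitInterval) (x z : Fin n), x ≠ z → z ≠ b → z ≠ c → z ≠ y →
      Q44b.sureJoined (Function.update w s(x, z) 0) a x →
        bil (Function.update w s(x, z) 0) (Function.update w s(x, z) 0) a b c y ≤
          bil (Function.update w s(x, z) 0) (Function.update w s(x, z) 1) a b c y +
            bil (Function.update w s(x, z) 1) (Function.update w s(x, z) 0) a b c y)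
    (w : Sym2 (Fin n) → unitInterval) : 0 ≤ law w a b c y :=
  law_nonneg_of_eMonoA a b c y (eMonoA_of_nonterminal a b c y h) w

/-- **The single-source packing inequality, all `n`, from E-MONO-A at the non-terminal pairs only**, in the literal cell form of
`TwoCopyMono.pack_singleSource_of_monoA` / `SingleSourceLaw.pack_singleSource_of_eMonoA`. [this work] -/
theorem pack_singleSource_of_eMonoA_nonterminal (a b c y : Fin n)
    (h : ∀ (w : Sym2 (Fin n) → unitInterval) (x z : Fin n), x ≠ z → z ≠ b → z ≠ c → z ≠ y →
      Q44b.sureJoined (Function.update w s(x, z) 0) a x →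
        bil (Function.update w s(x, z) 0) (Function.update w s(x, z) 0) a b c y ≤
          bil (Function.update w s(x, z) 0) (Function.update w s(x, z) 1) a b c y +
            bil (Function.update w s(x, z) 1) (Function.update w s(x, z) 0) a b c y)
    (w : Sym2 (Fin n) → unitInterval) :
    cell w a b c y 6 * cell w a b c y 7 + cell w a b c y 5 * cell w a b c y 7 + cell w a b c y 11 * cell w a b c y 9 +
      cell w a b c y 11 * cell w a b c y 8 + cell w a b c y 6 * cell w a b c y 8 + cell w a b c y 6 * cell w a b c y 1 +
      cell w a b c y 8 * cell w a b c y 1 ≤ (cell w a b c y 11 + cell w a b c y 14) * cell w a b c y 0 :=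
  pack_singleSource_of_eMonoA a b c y (eMonoA_of_nonterminal a b c y h) w

end SingleSourceLaw

end Summit.CriticalPhenomena.PercolationContinuityZ3.Theorems
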